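import Summits.HodgeConjecture.CorCM.GaloisSectionCountFixed
import HarnessLib

/-!
# Counting sections, III: the union bound with the badly-twisted indices removed

COR-CM (cell `pub-hodgecm2`), binder seat b04 (gen 36), count-neutral own lane «Galois-CM-type classification».  KERNEL ONLY,
Mathlib only: theorems; no definition, no named fact, no `sorry`.  Sequel of `CorCM/GaloisSectionCountFixed` (gen 32): in the
union bound `Σ_v 2^((|α| + f_v)/2) < 2^|α|` for the affine systems `ε(ψ_v z) = ε(z) ⊻ τ_v(z)`, an index `v` whose `ψ_v` has a fixed
point with the NON-trivial twist `τ_v = true` has no solution at all and may be dropped from the sum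
(`filter_twisted_eq_empty_of_bad`, **`exists_forall_violated_bad`**).  Used by `CorCM/GaloisSkewSectionClasses` (skew CM sets at
order `32`: the conjugates of `cu` never stabilise a section).

## References

* [Kubota1965] T. Kubota, *On the field extension by complex multiplication*, Trans. AMS 118 (1965), §2 (context only).
-/

namespace Summit.HodgeConjecture.CorCM.GaloisModels.SectionCount

open Finset

variable {α : Type*} [Fintype α] [DecidableEq α]

/-- A fixed point with the non-trivial twist kills every solution of `ε(ψ z) = ε(z) ⊻ τ(z)`. [folklore] -/
theorem filter_twisted_eq_empty_of_bad (ψ : α → α) (τ : α → Bool) (hbad : ∃ z, ψ z = z ∧ τ z = true) :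
    (Finset.univ.filter fun ε : α → Bool => ∀ z, ε (ψ z) = xor (ε z) (τ z)) = ∅ := by
  obtain ⟨z, hz, hτ⟩ := hbad
  refine Finset.eq_empty_of_forall_notMem fun ε hε => ?_
  have h := (Finset.mem_filter.1 hε).2 z
  rw [hz, hτ] at h
  cases h1 : ε z <;> simp_all

/-- **UNION BOUND with the badly-twisted indices removed.**  If `Σ 2^((|α| + f_v)/2) < 2^|α|`, the sum over those `v ∈ V` whose
`ψ_v` has NO fixed point with `τ_v = true` (`f_v` = number of fixed points with `τ_v = false`), then some `ε : α → Bool` violates,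
for EVERY `v ∈ V`, at least one constraint `ε(ψ_v z) = ε(z) ⊻ τ_v(z)`. [folklore] -/
theorem exists_forall_violated_bad {ι : Type*} (V : Finset ι) (ψ : ι → α → α) (hinj : ∀ v ∈ V, Function.Injective (ψ v))
    (τ : ι → α → Bool)
    (hbig : ∑ v ∈ V.filter (fun v => ¬ ∃ z, ψ v z = z ∧ τ v z = true),
      2 ^ ((Fintype.card α + (Finset.univ.filter fun z : α => ψ v z = z ∧ τ v z = false).card) / 2)
      < 2 ^ Fintype.card α) :
    ∃ ε : α → Bool, ∀ v ∈ V, ∃ z, ε (ψ v z) ≠ xor (ε z) (τ v z) := by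
  classical
  by_contra H
  set V' := V.filter (fun v => ¬ ∃ z, ψ v z = z ∧ τ v z = true) with hV'
  have hcover : (Finset.univ : Finset (α → Bool)) ⊆
      V'.biUnion fun v => Finset.univ.filter fun ε : α → Bool => ∀ z, ε (ψ v z) = xor (ε z) (τ v z) := by
    intro ε _
    rw [Finset.mem_biUnion]
    by_contra h
    refine H ⟨ε, fun v hv => ?_⟩
    by_contra h'
    have hsol : ∀ z, ε (ψ v z) = xor (ε z) (τ v z) := fun z => by by_contra h''; exact h' ⟨z, h''⟩
    have hv' : v ∈ V' := by
      rw [hV', Finset.mem_filter]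
      refine ⟨hv, fun hbad => ?_⟩
      have he := filter_twisted_eq_empty_of_bad (ψ v) (τ v) hbad
      have : ε ∈ (Finset.univ.filter fun ε : α → Bool => ∀ z, ε (ψ v z) = xor (ε z) (τ v z)) :=
        Finset.mem_filter.2 ⟨Finset.mem_univ _, hsol⟩
      rw [he] at this
      exact Finset.notMem_empty _ this
    exact h ⟨v, hv', Finset.mem_filter.2 ⟨Finset.mem_univ _, hsol⟩⟩
  have h1 := Finset.card_le_card hcover
  have h2 : (V'.biUnion fun v => Finset.univ.filter fun ε : α → Bool => ∀ z, ε (ψ v z) = xor (ε z) (τ v z)).card ≤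
      ∑ v ∈ V', 2 ^ ((Fintype.card α + (Finset.univ.filter fun z : α => ψ v z = z ∧ τ v z = false).card) / 2) :=
    (Finset.card_biUnion_le).trans (Finset.sum_le_sum fun v hv =>
      card_filter_twisted_le_fix (ψ v) (hinj v (Finset.mem_filter.1 hv).1) (τ v))
  rw [Finset.card_univ, Fintype.card_fun, Fintype.card_bool] at h1
  omega

end Summit.HodgeConjecture.CorCM.GaloisModels.SectionCount
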